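import Summits.ABC.StewartYu.ArchG3LevelsD
import Summits.ABC.StewartYu.ArchG3StepPacks
import HarnessLib

/-!
# Cell abc-stewartyu, rung A1.L (crux r2 `ArchCoreRat`), WP-L.A: RECORD PACKAGES of the archimedean k-steps with GENERIC MONOMIAL
# DENOMINATORS and a VIRTUAL-BOX predicate `V` (ruling R34 / R34-implementation, vehicle file 3)

`Summits/ABC/StewartYu/ArchG3StepPacksD.lean` — cell `abc-stewartyu` (HOME `run/shared/lean/pub/abc-stewartyu/`; seat lp-1 g8).  Two definitions
and theorems on `ArchG3Setup`; no named fact, no numerics.  Sequel of `ArchG3StepPacks` (✓): `ArchKStepHypD` / `ArchKStepOddHypD` are the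
texts of `ArchKStepHypU` / `ArchKStepOddHypU` with
* a monomial denominator `Dm : ℤ → ℕ` (`Dm x ≥ 1`) next to the Hasse denominators `den₀ a x`, and the CLEARING OBLIGATION
  `∀ x, |x| ≤ N′ → ∀ w′ in the box with V w′, Dm x · ∏ⱼ αⱼ^{w′ⱼ x} ∈ ℤ` as a field, where `V : (Fin n → ℤ) → Prop` is a free pointwise
  predicate on relative exponent vectors (intended at `S(θ)`: the VIRTUAL box `|ν(w′)ⱼ| ≤ Bvⱼ` of the saturated data, R32 (a)/R34; `V = ⊤`
  and `Dm = monDen(α, L|x|)` recover `ArchKStepHypU`);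
* the numerical inequality against `1/(den₀ a x₁ · Dm x₁)` (left-hand side verbatim).
`ArchLvInv.kstep_of_hypD` / `kstep_odd_of_hypD` (extra hypothesis `hV : ∀ i ∈ B, V (v i)`), `kchainD`, `levelRunD`.

WHAT THIS IS NOT: no change to `ArchG3StepPacks`; no choice of `Dm`/`V`; no crux moves.

References: Yu. V. Nesterenko, LNM 1819 (2003) §4.2 (4.24)–(4.35) p. 84–90, §3.5 (3.41)–(3.44) p. 76–78 [Nesterenko2003]; K. Yu, Acta
Math. 211 (2013) Lemma 5.2 [Yu2013].
-/

noncomputable section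

open Finset Polynomial
open Literature.NumberTheory.Transcendental
open Literature.NumberTheory.Transcendental.CW77.Setup (Tau tauNorm)
open scoped Nat

namespace Summit.ABC.StewartYu

namespace ArchG3Setup

variable (S : ArchG3Setup) {ι : Type*}

/-! ### The packages -/

/-- **Record package of one archimedean k-step, generic denominators** (symmetric nodes `|x| ≤ N → |x| ≤ N′`, orders `T → T′`), uniform over `i ∈ U` and the
box `|wⱼ| ≤ Lⱼ` with `V w`; `δ₀` is the frame's majorant of `|Λ/b_{j₀}|`, `γb` of the slab centre `|γ|`; `Dm` clears the monomials. [cite: Nesterenko2003, §4.2 (4.24)–(4.35), p. 87–90; shape only] -/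
def ArchKStepHypD (R : ι → ℚ[X]) (U : Finset ι) (L : Fin S.n → ℕ) (P : ℤ) (w γb : ℝ) (c : ℤ) (e : Fin S.n → ℤ) (δ₀ : ℝ)
    (V : (Fin S.n → ℤ) → Prop) (N N' T T' : ℕ) : Prop :=
  ∃ (t : ℕ) (A Γ : Fin S.n → ℝ) (DΔ E Wd Wn C : ℝ) (den₀ : ℕ → ℤ → ℕ) (Dm : ℤ → ℕ),
    1 ≤ t ∧ T' + t ≤ T ∧ N' ≤ 3 * N + 2 ∧
    (∀ k, |S.lg k| ≤ A k) ∧ (∀ k, 0 ≤ Γ k) ∧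
    (∀ w' : Fin S.n → ℤ, (∀ j, |w' j| ≤ (L j : ℤ)) → ∀ k, |(S.zγ w' k : ℝ)| ≤ Γ k) ∧
    0 ≤ DΔ ∧
    (∀ w' : Fin S.n → ℤ, (∀ j, |w' j| ≤ (L j : ℤ)) → ∀ (a : ℕ) (μ : Fin S.n → ℕ), a + ∑ k, μ k < T' →
      |((∏ k, Ring.multichoose (S.yΔ c e w' k) (μ k) : ℤ) : ℝ)| ≤ DΔ) ∧
    1 ≤ E ∧
    (∀ i ∈ U, ∀ a < T', ∀ z : ℂ, ‖z‖ ≤ (3 * E + 1) * (2 * N + 1) + N → ‖(hw R i a).eval z‖ ≤ Wd) ∧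
    0 ≤ Wn ∧
    (∀ i ∈ U, ∀ t₀ < T, ∀ x : ℤ, |x| ≤ 3 * (N : ℤ) + 2 → |(((hasseDeriv t₀ (R i)).eval (x : ℚ) : ℚ) : ℝ)| ≤ Wn) ∧
    0 ≤ w ∧ (L S.j₀ : ℝ) * δ₀ * (3 * N + 2) ≤ 1 ∧ 1 ≤ C ∧
    (∀ a x, 1 ≤ den₀ a x) ∧
    (∀ a < T', ∀ x : ℤ, |x| ≤ (N' : ℤ) → ∀ i ∈ U, ∃ z₀ : ℤ, (den₀ a x : ℚ) * (hasseDeriv a (R i)).eval (x : ℚ) = z₀) ∧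
    (∀ x, 1 ≤ Dm x) ∧
    (∀ x : ℤ, |x| ≤ (N' : ℤ) → ∀ w' : Fin S.n → ℤ, (∀ j, |w' j| ≤ (L j : ℤ)) → V w' →
      ∃ z₂ : ℤ, (Dm x : ℚ) * ∏ j, S.α j ^ (w' j * x) = z₂) ∧
    (∀ x₁ : ℤ, |x₁| ≤ (N' : ℤ) → ∀ (a : ℕ) (μ : Fin S.n → ℕ), a + ∑ k, μ k < T' →
      Real.exp (γb * N') *
        (2 * ((2 * N + 1 : ℕ) : ℝ) ^ (t + 1) * t * (20 * Real.exp 1) ^ ((2 * N + 1) * t) *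
            ((2 * C) ^ t * Real.exp (γb * (N + 1)) *
              ((2 : ℝ) ^ a * Real.exp ((∑ k, A k * Γ k) / C) *
                (U.card * (P * DΔ) * Wn * Real.exp ((γb + w) * N) * (2 * ((L S.j₀ : ℝ) * δ₀ * N))))) +
          U.card * (P * DΔ) * Wd * Real.exp ((w + (L S.j₀ : ℝ) * δ₀) * ((3 * E + 1) * (2 * N + 1) + N)) *
            (1 / E) ^ ((2 * N + 1) * t)) +
        U.card * (P * DΔ) * Wn * Real.exp ((γb + w) * N') * (2 * ((L S.j₀ : ℝ) * δ₀ * N')) <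
      1 / ((den₀ a x₁ * Dm x₁ : ℕ) : ℝ))

/-- **Record package of the first k-step of a level, generic denominators** (odd nodes `|x| ≤ 2m − 1 → |x| ≤ N′`, orders `T → T′`).
[cite: Nesterenko2003, §4.2 with the nodes 𝒳_{s,0}, p. 87–90; shape only] -/
def ArchKStepOddHypD (R : ι → ℚ[X]) (U : Finset ι) (L : Fin S.n → ℕ) (P : ℤ) (w γb : ℝ) (c : ℤ) (e : Fin S.n → ℤ) (δ₀ : ℝ)
    (V : (Fin S.n → ℤ) → Prop) (m N' T T' : ℕ) : Prop :=
  ∃ (t : ℕ) (A Γ : Fin S.n → ℝ) (DΔ E Wd Wn C : ℝ) (den₀ : ℕ → ℤ → ℕ) (Dm : ℤ → ℕ),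
    1 ≤ m ∧ 1 ≤ t ∧ T' + t ≤ T ∧ N' ≤ 6 * m ∧
    (∀ k, |S.lg k| ≤ A k) ∧ (∀ k, 0 ≤ Γ k) ∧
    (∀ w' : Fin S.n → ℤ, (∀ j, |w' j| ≤ (L j : ℤ)) → ∀ k, |(S.zγ w' k : ℝ)| ≤ Γ k) ∧
    0 ≤ DΔ ∧
    (∀ w' : Fin S.n → ℤ, (∀ j, |w' j| ≤ (L j : ℤ)) → ∀ (a : ℕ) (μ : Fin S.n → ℕ), a + ∑ k, μ k < T' →
      |((∏ k, Ring.multichoose (S.yΔ c e w' k) (μ k) : ℤ) : ℝ)| ≤ DΔ) ∧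
    1 ≤ E ∧
    (∀ i ∈ U, ∀ a < T', ∀ z : ℂ, ‖z‖ ≤ (12 * E + 6) * m → ‖(hw R i a).eval z‖ ≤ Wd) ∧
    0 ≤ Wn ∧
    (∀ i ∈ U, ∀ t₀ < T, ∀ x : ℤ, |x| ≤ 6 * (m : ℤ) → |(((hasseDeriv t₀ (R i)).eval (x : ℚ) : ℚ) : ℝ)| ≤ Wn) ∧
    0 ≤ w ∧ (L S.j₀ : ℝ) * δ₀ * (6 * m) ≤ 1 ∧ 1 ≤ C ∧
    (∀ a x, 1 ≤ den₀ a x) ∧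
    (∀ a < T', ∀ x : ℤ, |x| ≤ (N' : ℤ) → ∀ i ∈ U, ∃ z₀ : ℤ, (den₀ a x : ℚ) * (hasseDeriv a (R i)).eval (x : ℚ) = z₀) ∧
    (∀ x, 1 ≤ Dm x) ∧
    (∀ x : ℤ, |x| ≤ (N' : ℤ) → ∀ w' : Fin S.n → ℤ, (∀ j, |w' j| ≤ (L j : ℤ)) → V w' →
      ∃ z₂ : ℤ, (Dm x : ℚ) * ∏ j, S.α j ^ (w' j * x) = z₂) ∧
    (∀ x₁ : ℤ, |x₁| ≤ (N' : ℤ) → ∀ (a : ℕ) (μ : Fin S.n → ℕ), a + ∑ k, μ k < T' →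
      Real.exp (γb * N') *
        (2 * ((2 * m : ℕ) : ℝ) ^ (t + 1) * t * (20 * Real.exp 1) ^ ((2 * m) * t) *
            (2 ^ t * ((2 * C) ^ t * Real.exp (γb * (2 * m)) *
              ((2 : ℝ) ^ a * Real.exp ((∑ k, A k * Γ k) / C) *
                (U.card * (P * DΔ) * Wn * Real.exp ((γb + w) * ((2 * m - 1 : ℕ) : ℝ)) *
                  (2 * ((L S.j₀ : ℝ) * δ₀ * ((2 * m - 1 : ℕ) : ℝ))))))) +
          U.card * (P * DΔ) * Wd * Real.exp ((w + (L S.j₀ : ℝ) * δ₀) * ((12 * E + 6) * m)) * (1 / E) ^ ((2 * m) * t)) +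
        U.card * (P * DΔ) * Wn * Real.exp ((γb + w) * N') * (2 * ((L S.j₀ : ℝ) * δ₀ * N')) <
      1 / ((den₀ a x₁ * Dm x₁ : ℕ) : ℝ))

/-! ### The k-steps from the packages -/

namespace ArchLvInv

variable {S} {R : ι → ℚ[X]} {U B : Finset ι} {v : ι → Fin S.n → ℤ} {pv : ι → ℤ} {lo : Fin S.n → ℤ} {L : Fin S.n → ℕ} {P : ℤ}
  {w γ γb : ℝ} {c : ℤ} {e : Fin S.n → ℤ} {δ₀ : ℝ} {T T' N N' m : ℕ}

/-- **One k-step from the generic package** (`B ⊆ U`, `|Λ/b_{j₀}| ≤ δ₀`, `V` on the family). [cite: Nesterenko2003, §4.2 (4.24)–(4.35), p. 87–90] -/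
theorem kstep_of_hypD {V : (Fin S.n → ℤ) → Prop} (hBU : B ⊆ U) (h : S.ArchLvInv R B v pv lo L P w γ c e {x : ℤ | |x| ≤ (N : ℤ)} T)
    (hΛ : |S.Λ / (S.b S.j₀ : ℝ)| ≤ δ₀) (hγ : |γ| ≤ γb) (hV : ∀ i ∈ B, V (v i)) (H : S.ArchKStepHypD R U L P w γb c e δ₀ V N N' T T') :
    S.ArchLvInv R B v pv lo L P w γ c e {x : ℤ | |x| ≤ (N' : ℤ)} T' := by
  obtain ⟨t, A, Γ, DΔ, E, Wd, Wn, C, den₀, Dm, ht, hT, hN', hA, hΓ0, hΓ, hDΔ0, hDΔ, hE, hWd, hWn0, hWn, hw0, hsmall, hC, hden₀, hR,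
    hDm, hmon, hfinal⟩ := H
  obtain ⟨i₀, hi₀B, _⟩ := h.nonzero
  have hBc : (B.card : ℝ) ≤ U.card := by exact_mod_cast card_le_card hBU
  have hPD : 0 ≤ (P : ℝ) * DΔ := mul_nonneg h.P_nonneg hDΔ0
  refine h.kstepD ht hT hN' hBc hA hΓ0 (fun i hi k => hΓ (v i) (h.abs_le i hi) k) hPD
    (fun a μ haμ => h.abs_pvΔ_le_of_box fun w' hw' => hDΔ w' hw' a μ haμ) hE (fun i hi => hWd i (hBU hi)) hWn0
    (fun i hi => hWn i (hBU hi)) hw0 hΛ hsmall hC den₀ hden₀ (fun a ha x hx i hi => hR a ha x hx i (hBU hi)) Dm hDm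
    (fun x hx i hi => hmon x hx (v i) (h.abs_le i hi) (hV i hi)) ?_
  intro x₁ hx₁ a μ haμ
  refine lt_of_le_of_lt ?_ (hfinal x₁ hx₁ a μ haμ)
  have hγ0 : 0 ≤ |γ| := abs_nonneg _
  have hWd0 : 0 ≤ Wd := le_trans (norm_nonneg _) (hWd i₀ (hBU hi₀B) a (by omega) 0 (by simp; positivity))
  have hU0 : (0 : ℝ) ≤ U.card := Nat.cast_nonneg _
  have hδ₀ : 0 ≤ δ₀ := (abs_nonneg _).trans hΛ
  have hC0 : 0 < C := by linarith
  set PD : ℝ := (P : ℝ) * DΔ with hPDdef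
  gcongr

/-- **The first k-step of a level from the generic package** (`V` on the family). [cite: Nesterenko2003, §4.2 with the nodes 𝒳_{s,0}, p. 87–90] -/
theorem kstep_odd_of_hypD {V : (Fin S.n → ℤ) → Prop} (hBU : B ⊆ U)
    (h : S.ArchLvInv R B v pv lo L P w γ c e {x : ℤ | Odd x ∧ |x| ≤ 2 * (m : ℤ) - 1} T)
    (hΛ : |S.Λ / (S.b S.j₀ : ℝ)| ≤ δ₀) (hγ : |γ| ≤ γb) (hV : ∀ i ∈ B, V (v i)) (H : S.ArchKStepOddHypD R U L P w γb c e δ₀ V m N' T T') :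
    S.ArchLvInv R B v pv lo L P w γ c e {x : ℤ | |x| ≤ (N' : ℤ)} T' := by
  obtain ⟨t, A, Γ, DΔ, E, Wd, Wn, C, den₀, Dm, hm, ht, hT, hN', hA, hΓ0, hΓ, hDΔ0, hDΔ, hE, hWd, hWn0, hWn, hw0, hsmall, hC, hden₀,
    hR, hDm, hmon, hfinal⟩ := H
  obtain ⟨i₀, hi₀B, _⟩ := h.nonzero
  have hBc : (B.card : ℝ) ≤ U.card := by exact_mod_cast card_le_card hBU
  have hPD : 0 ≤ (P : ℝ) * DΔ := mul_nonneg h.P_nonneg hDΔ0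
  refine h.kstep_oddD hm ht hT hN' hBc hA hΓ0 (fun i hi k => hΓ (v i) (h.abs_le i hi) k) hPD
    (fun a μ haμ => h.abs_pvΔ_le_of_box fun w' hw' => hDΔ w' hw' a μ haμ) hE (fun i hi => hWd i (hBU hi)) hWn0
    (fun i hi => hWn i (hBU hi)) hw0 hΛ hsmall hC den₀ hden₀ (fun a ha x hx i hi => hR a ha x hx i (hBU hi)) Dm hDm
    (fun x hx i hi => hmon x hx (v i) (h.abs_le i hi) (hV i hi)) ?_
  intro x₁ hx₁ a μ haμ
  refine lt_of_le_of_lt ?_ (hfinal x₁ hx₁ a μ haμ)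
  have hγ0 : 0 ≤ |γ| := abs_nonneg _
  have hWd0 : 0 ≤ Wd := le_trans (norm_nonneg _) (hWd i₀ (hBU hi₀B) a (by omega) 0 (by simp; positivity))
  have hU0 : (0 : ℝ) ≤ U.card := Nat.cast_nonneg _
  have hδ₀ : 0 ≤ δ₀ := (abs_nonneg _).trans hΛ
  have hC0 : 0 < C := by linarith
  set PD : ℝ := (P : ℝ) * DΔ with hPDdef
  gcongr

/-! ### The chain of k-steps at one level -/

/-- **`k` consecutive symmetric k-steps** along the schedules `N ν` (node radii) and `T ν` (orders), from `ν₀` to `ν₀ + k`.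
[cite: Nesterenko2003, §4.2 (the induction on ν), p. 84–90] -/
theorem kchainD {V : (Fin S.n → ℤ) → Prop} (hBU : B ⊆ U) (hΛ : |S.Λ / (S.b S.j₀ : ℝ)| ≤ δ₀) (hγ : |γ| ≤ γb) (hV : ∀ i ∈ B, V (v i))
    (Nν Tν : ℕ → ℕ) (ν₀ : ℕ) :
    ∀ k : ℕ, (∀ ν, ν₀ ≤ ν → ν < ν₀ + k → S.ArchKStepHypD R U L P w γb c e δ₀ V (Nν ν) (Nν (ν + 1)) (Tν ν) (Tν (ν + 1))) →
      S.ArchLvInv R B v pv lo L P w γ c e {x : ℤ | |x| ≤ (Nν ν₀ : ℤ)} (Tν ν₀) →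
      S.ArchLvInv R B v pv lo L P w γ c e {x : ℤ | |x| ≤ (Nν (ν₀ + k) : ℤ)} (Tν (ν₀ + k)) := by
  intro k
  induction k with
  | zero => intro _ h; simpa using h
  | succ k ih =>
    intro hyp h
    have h1 := ih (fun ν h0 h1 => hyp ν h0 (by omega)) h
    have h2 := kstep_of_hypD hBU h1 hΛ hγ hV (hyp (ν₀ + k) (by omega) (by omega))
    rwa [show ν₀ + (k + 1) = ν₀ + k + 1 by omega]

/-- **The k-steps of one level**: from the odd-node state (`𝒳_{s,0}`: odd `|x| ≤ 2m − 1`, order `Tν 0`) through the odd-node step to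
`(Nν 1, Tν 1)` and then `k` symmetric steps to `(Nν (1 + k), Tν (1 + k))`. [cite: Nesterenko2003, §4 Prop. 4.1, §4.2, p. 80–90] -/
theorem levelRunD {V : (Fin S.n → ℤ) → Prop} (hBU : B ⊆ U) (hΛ : |S.Λ / (S.b S.j₀ : ℝ)| ≤ δ₀) (hγ : |γ| ≤ γb)
    (hV : ∀ i ∈ B, V (v i)) (Nν Tν : ℕ → ℕ) (k : ℕ)
    (hO : S.ArchKStepOddHypD R U L P w γb c e δ₀ V m (Nν 1) (Tν 0) (Tν 1))
    (hK : ∀ ν, 1 ≤ ν → ν < 1 + k → S.ArchKStepHypD R U L P w γb c e δ₀ V (Nν ν) (Nν (ν + 1)) (Tν ν) (Tν (ν + 1)))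
    (h : S.ArchLvInv R B v pv lo L P w γ c e {x : ℤ | Odd x ∧ |x| ≤ 2 * (m : ℤ) - 1} (Tν 0)) :
    S.ArchLvInv R B v pv lo L P w γ c e {x : ℤ | |x| ≤ (Nν (1 + k) : ℤ)} (Tν (1 + k)) :=
  kchainD hBU hΛ hγ hV Nν Tν 1 k hK (kstep_odd_of_hypD hBU h hΛ hγ hV hO)

end ArchLvInv

end ArchG3Setup

end Summit.ABC.StewartYu

end
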